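import Summits.BirchSwinnertonDyer.BirchSwinnertonDyer.Theorems.ManinLocalTwoThreeManinPrimeToAdditiveFiveLeGloballyTwistMinimal
import Summits.BirchSwinnertonDyer.BirchSwinnertonDyer.Theorems.AdditiveKolyvaginRoadManinFrameResidueProperRTameTwistFull57
import Summits.BirchSwinnertonDyer.Rank1Residual.ManinAdditive.TwistOrbitManinStatements
import HarnessLib

/-!
# Route `ManinLocalTwoThree`, residual crux C5 `ManinPrimeToAdditiveFiveLe` (stmt-BirchSwinnertonDyer-22969):
# **the KATO REDUCTION — C5 ⟸ Kato's Néron-integral zeta elements (two cite-only tree facts) +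
# the Kosters–Pannekoek corner at `p ∈ {5,7}` + the `W[p]`-reducible residue**

CONDITIONAL reduction (a `--supports` helper; C5 is NOT proved here). Line `upper_anchor` of the crux splits
C5 into a commuting-pair calculus (stubs `stub_upperAnchor`, `stub_directionLaw`) on the `W[p]`-irreducible
locus plus the reducible residue (`stub_reducibleTwistMinimal`). This file records that on the IRREDUCIBLE
locus NO pair calculus is needed once one grants the tree's statement-only readings of Kato's Euler system
in Néron units at an additive prime (cell `pub/bsd-wall`, crux `ManinFrameResidueProperR`, tame-twist
lever; Kato 2004 (8.1.3)/Thm 9.7/Thm 6.6 (1) + Kim–Nakamura 2020 Cor. 2.4 ⟸ Kosters–Pannekoek 2017 Thm 1):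
* F′ = `kato_neron_isIntegral_twistedSymbolSum_of_additive` (`p > 7`, no side clause) gives `p ∤ c` at
  EVERY lattice-optimal datum of EVERY globally minimal curve additive at `p > 7` with `E[p]` irreducible
  (`ManinFrameResidueProperRTameTwist.not_dvd_c_of_tameTwistL`, seat bsd-wall-manin-p1 g3) — including
  Edixhoven's exceptional potentially-ordinary Kodaira II/III/IV curves;
* F″ = `kato_neron_isIntegral_twistedSymbolSum_of_additive_five_le` gives the same at `p ∈ {5, 7}` OFF the
  Kosters–Pannekoek exception `W(ℚ_p)[p] ≠ 0` (`…not_dvd_c_of_tameTwist57`, g4).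
Hence (§1) `maninLocalTwoThree_not_dvd_maninConstant_of_kato_of_irreducible`, and (§2) crux C5 BY NAME
follows from F′, F″ and exactly two cores, both on the GLOBALLY TWIST-MINIMAL classes of the route helper
p587193 with conductor-level lattice-optimal data:
* (KP) `p ∈ {5,7}`, `E[p]` irreducible, `W(ℚ_p)` HAS a point of order `p` (by Kosters–Pannekoek Cor. 2 and
  the tree's `kp_types_of_torsion_witness`: Kodaira II/III at `5`, II at `7` — the potentially ordinary
  Kummer corner, where Kato's bound stops at `v_p(c) ≤ 1`; = the territory of crux KP57
  stmt-BirchSwinnertonDyer-23810 of route `EdixhovenFibreFiveSeven`);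
* (RED) `E[p]` REDUCIBLE, `p ≥ 5` — verbatim the registered stub `stub_reducibleTwistMinimal` of line
  `upper_anchor` (so §2 reads: C5 ⟸ F′ ∧ F″ ∧ (KP) ∧ stub 2).

HONEST SCOPE. Conditional on two unproved named facts (cite-only «derived readings» with a referee flag in
their docstrings; the gate records `conditional-result`); closes nothing; (KP) and (RED) stay open. Compared
with the Edixhoven reduction (`…EdixhovenReduction`, p607525) the open core on the irreducible locus shrinks
from «p ∈ {5,7} ∪ (G)-ordinary II/III/IV at p > 7» to the Kosters–Pannekoek corner at `p ∈ {5,7}` alone.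
BSD is not proved by this; C5 is not proved by this; Manin's conjecture is not proved by this.
Seat bsd-line-ml23-c5-p1 (lead).

References: [Kato2004Asterisque] (8.1.3), Thm. 9.7, Thm. 6.6 (1); [KimNakamura2020] Thm. 2.1, Cor. 2.4;
[KostersPannekoek2017] Thm. 1, Cor. 2; [KrausOesterle1992] (a_ℓ = ±1 at ℓ ∥ N); [EdixhovenManin1991] §1, Thm. 3;
[Stevens1989] (5.2), (5.4) (the frame p587193).
-/

set_option autoImplicit false
set_option linter.dupNamespace false

noncomputable section

open scoped Classical NumberField

namespace Summit.BirchSwinnertonDyer.BirchSwinnertonDyer.Theorems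

open WeierstrassCurve IsDedekindDomain IsDedekindDomain.HeightOneSpectrum Rat.HeightOneSpectrum
  NumberField
  Literature.NumberTheory.EllipticCurves Literature.NumberTheory.EllipticCurves.ModularForms
  Literature.NumberTheory.EllipticCurves.Rank1Residual
  Summit.BirchSwinnertonDyer.Rank1Residual.Additive
  Summit.BirchSwinnertonDyer.Rank1Residual.ManinAdditive

/-! ## §1 The irreducible locus, granted F′ and F″ -/

/-- **Manin's `p`-part at an additive `p ≥ 5` with `E[p]` irreducible, GRANTED Kato's Néron integrality
(F′ at `p > 7`, F″ at `p ∈ {5,7}`) — off the Kosters–Pannekoek exception at `p ∈ {5,7}`.** For `W/ℚ`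
globally minimal with a lattice-optimal datum `D` at a level `N` with `p² ∣ N` (so `N = N(W)` granted
modularity and `W` is additive at `p`), `E[p]` irreducible, and — only when `p ∈ {5,7}` — no point of order
`p` in `W(ℚ_p)`: `p ∤ c(D)`. Proof: `N = N(W)` (`IsNewformOf.level_eq_conductorNorm_of_exists_isNewformOf`),
`a_ℓ = ±1` at `ℓ ∥ N` (Kraus–Oesterlé), then the tame-twist lever of cell `pub/bsd-wall`
(`not_dvd_c_of_tameTwistL` / `not_dvd_c_of_tameTwist57`). CONDITIONAL on F′, F″.
[cite: Kato2004Asterisque, (8.1.3) (p. 180), Thm. 9.7 (p. 189), Thm. 6.6 (1) (p. 163)]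
[cite: KimNakamura2020, Thm. 2.1, Cor. 2.4] [cite: KostersPannekoek2017, Thm. 1 and Cor. 2] -/
theorem maninLocalTwoThree_not_dvd_maninConstant_of_kato_of_irreducible
    (hK : kato_neron_isIntegral_twistedSymbolSum_of_additive)
    (hK57 : kato_neron_isIntegral_twistedSymbolSum_of_additive_five_le)
    (hnf : exists_isNewformOf)
    (W : WeierstrassCurve ℚ) [W.IsElliptic] [W.IsGloballyMinimal] {N : ℕ} [NeZero N]
    (D : ModularParametrizationData W N)
    (hopt : ∀ z ∈ D.L.lattice, ∃ w ∈ periodLattice D.f, z = D.c * w)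
    {p : ℕ} [Fact p.Prime] (h5 : 5 ≤ p) (hpN : p ^ 2 ∣ N) (hirr : W.HasIrreducibleModPGaloisRep p)
    (hPT : p = 5 ∨ p = 7 → ∀ P : (W.baseChange ℚ_[p]).toAffine.Point, p • P = 0 → P = 0) :
    ¬ (p : ℤ) ∣ D.maninConstant := by
  have hp : p.Prime := Fact.out
  have hN : N = W.conductorNorm ℤ :=
    IsNewformOf.level_eq_conductorNorm_of_exists_isNewformOf hnf D.isNewformOf
  subst hN
  have hadd : Addv W p := not_good_and_not_mult_of_sq_dvd_conductorNorm W hpN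
  -- `a_ℓ = ±1` at the multiplicative primes `ℓ ∥ N(W)` (Kraus–Oesterlé)
  have ha : ∀ ℓ ∈ (W.conductorNorm ℤ).primeFactors, ¬ ℓ ^ 2 ∣ W.conductorNorm ℤ →
      W.LFunction ℓ = 1 ∨ W.LFunction ℓ = -1 := by
    intro ℓ hℓ hℓ2
    haveI : Fact ℓ.Prime := ⟨Nat.prime_of_mem_primeFactors hℓ⟩
    rcases hasGoodReductionAtPrime_or_hasMultiplicativeReductionAtPrime_of_not_sq_dvd_conductorNorm
      (V := W) hℓ2 with hg | hmul
    · exact absurd (Nat.dvd_of_mem_primeFactors hℓ) (not_dvd_conductorNorm_of_hasGoodReductionAtPrime W hg)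
    · exact KrausOesterle1992.lFunction_apply_prime_eq_one_or_eq_neg_one_of_mult W ℓ hmul
  by_cases h57 : p = 5 ∨ p = 7
  · exact ManinFrameResidueProperRTameTwist.not_dvd_c_of_tameTwist57 hK57 h57 W D hopt (hPT h57) hadd
      hirr hpN ha
  · have h7 : 7 < p := by
      obtain ⟨hp5, hp7⟩ := not_or.mp h57
      have hp6 : p ≠ 6 := by rintro rfl; norm_num at hp
      omega
    exact ManinFrameResidueProperRTameTwist.not_dvd_c_of_tameTwistL hK W D hopt h7 hadd hirr hpN ha

/-! ## §2 C5 granted F′, F″: the Kosters–Pannekoek corner and the reducible residue remain -/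

/-- **KATO REDUCTION of C5 (conditional).** Granted the two statement-only Kato–Kim–Nakamura facts F′
(`p > 7`) and F″ (`p ∈ {5,7}` off the Kosters–Pannekoek exception), crux C5
`ManinLocalTwoThree.ManinPrimeToAdditiveFiveLe` follows from its restriction to
(KP) `p ∈ {5,7}`, `E[p]` irreducible, `W(ℚ_p)` has a point of order `p`, and
(RED) `E[p]` reducible — the latter VERBATIM the registered stub `stub_reducibleTwistMinimal` of line
`upper_anchor` —, both on globally twist-minimal classes (no odd `χ_{q*}` semistable untwist, no dyadic
semistable untwist) with conductor-level lattice-optimal data. C5 itself is NOT proved; (KP) is the territory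
of crux KP57 (stmt-BirchSwinnertonDyer-23810). [cite: Kato2004Asterisque, (8.1.3) (p. 180), Thm. 9.7 (p. 189)]
[cite: KimNakamura2020, Cor. 2.4] [cite: KostersPannekoek2017, Thm. 1 and Cor. 2] -/
theorem maninLocalTwoThree_maninPrimeToAdditiveFiveLe_of_kato_of_cores
    (hK : kato_neron_isIntegral_twistedSymbolSum_of_additive)
    (hK57 : kato_neron_isIntegral_twistedSymbolSum_of_additive_five_le)
    (hKP : ∀ (W : WeierstrassCurve ℚ) [W.IsElliptic] [W.IsGloballyMinimal]
      [NeZero (W.conductorNorm ℤ)] (D : ModularParametrizationData W (W.conductorNorm ℤ)),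
      IsLatticeOptimal D → ∀ (p : ℕ) [Fact p.Prime], (p = 5 ∨ p = 7) → p ^ 2 ∣ W.conductorNorm ℤ →
      ¬ (∃ (W' : WeierstrassCurve ℚ) (q : ℕ), W'.IsElliptic ∧ W'.IsGloballyMinimal ∧
          q.Prime ∧ q ≠ 2 ∧ q ^ 2 ∣ W.conductorNorm ℤ ∧
          IsIsogenous W (W'.quadraticTwist (((-1 : ℤ) ^ (q / 2) * q : ℤ) : ℚ)) ∧
          ¬ q ^ 2 ∣ W'.conductorNorm ℤ) →
      ¬ (∃ (W' : WeierstrassCurve ℚ) (d : ℤ), W'.IsElliptic ∧ W'.IsGloballyMinimal ∧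
          (d = -1 ∨ d = 2 ∨ d = -2) ∧ 2 ^ 2 ∣ W.conductorNorm ℤ ∧
          IsIsogenous W (W'.quadraticTwist (d : ℚ)) ∧ ¬ 2 ^ 2 ∣ W'.conductorNorm ℤ) →
      W.HasIrreducibleModPGaloisRep p →
      (∃ P : (W.baseChange ℚ_[p]).toAffine.Point, p • P = 0 ∧ P ≠ 0) →
      ¬ (p : ℤ) ∣ D.maninConstant)
    (hRED : mazur_not_dvd_maninConstant_of_odd → abbesUllmo_not_dvd_maninConstant_of_not_dvd_level →
      cesnavicius_not_two_dvd_maninConstant_of_two_dvd_level → exists_isNewformOf →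
      ∀ (W : WeierstrassCurve ℚ) [W.IsElliptic] [W.IsGloballyMinimal] [NeZero (W.conductorNorm ℤ)]
        (D : ModularParametrizationData W (W.conductorNorm ℤ)),
        IsLatticeOptimal D → ∀ p : ℕ, p.Prime → 5 ≤ p → p ^ 2 ∣ W.conductorNorm ℤ →
        ¬ (∃ (W' : WeierstrassCurve ℚ) (q : ℕ), W'.IsElliptic ∧ W'.IsGloballyMinimal ∧ q.Prime ∧
            q ≠ 2 ∧ q ^ 2 ∣ W.conductorNorm ℤ ∧
            IsIsogenous W (W'.quadraticTwist (((-1 : ℤ) ^ (q / 2) * q : ℤ) : ℚ)) ∧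
            ¬ q ^ 2 ∣ W'.conductorNorm ℤ) →
        ¬ (∃ (W' : WeierstrassCurve ℚ) (d : ℤ), W'.IsElliptic ∧ W'.IsGloballyMinimal ∧
            (d = -1 ∨ d = 2 ∨ d = -2) ∧ 2 ^ 2 ∣ W.conductorNorm ℤ ∧
            IsIsogenous W (W'.quadraticTwist (d : ℚ)) ∧ ¬ 2 ^ 2 ∣ W'.conductorNorm ℤ) →
        ¬ W.HasIrreducibleModPGaloisRep p →
        ¬ (p : ℤ) ∣ D.maninConstant) :
    Summit.BirchSwinnertonDyer.BirchSwinnertonDyer.Theses.ManinLocalTwoThree.ManinPrimeToAdditiveFiveLe := by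
  refine maninLocalTwoThree_maninPrimeToAdditiveFiveLe_of_globallyTwistMinimal ?_
  intro hM hAU hC hnf W hE hGM N hN0 D hopt p hp h5 hpN hodd hdy
  haveI hpF : Fact p.Prime := ⟨hp⟩
  have hN : N = W.conductorNorm ℤ :=
    IsNewformOf.level_eq_conductorNorm_of_exists_isNewformOf hnf D.isNewformOf
  subst hN
  have hD : IsLatticeOptimal D := hopt
  by_cases hirr : W.HasIrreducibleModPGaloisRep p
  · by_cases hT : ∃ P : (W.baseChange ℚ_[p]).toAffine.Point, p • P = 0 ∧ P ≠ 0
    · by_cases h57 : p = 5 ∨ p = 7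
      · exact hKP W D hD p h57 hpN hodd hdy hirr hT
      · -- at `p > 7` the torsion clause is idle
        exact maninLocalTwoThree_not_dvd_maninConstant_of_kato_of_irreducible hK hK57 hnf W D hopt h5
          hpN hirr (fun h ↦ absurd h h57)
    · push Not at hT
      exact maninLocalTwoThree_not_dvd_maninConstant_of_kato_of_irreducible hK hK57 hnf W D hopt h5 hpN
        hirr (fun _ P hP ↦ hT P hP)
  · exact hRED hM hAU hC hnf W D hD p hp h5 hpN hodd hdy hirr

end Summit.BirchSwinnertonDyer.BirchSwinnertonDyer.Theorems

end
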